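import Summits.QuantumFields.BalabanUV.Beta.GAN24.DressedWilsonHalfVertex
import Summits.QuantumFields.BalabanUV.Beta.GAN24.WilsonEdgeCurrentDiag

/-!
# `BalabanUV.Beta.GAN24.DressedWilsonHalfVertexAnyAxis` — binder row G-an2-4 ∕ (CONV-C), W-slot CT-W, conservation law (C)∕(C)sym, step (L2) of this lineage's note
# `HOME/b2b-balaban-gan24-formalise-leaf-04/g65/CSYM-LEVEL0-KERNEL-BLUEPRINT.md` §6: **THE SAME-AXIS (`μ = α`) BACKGROUND-RESUMMED DRESSED WILSON HALF-VERTEX VANISHES** —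
# the complement of the two `HasSum`s of `GAN24.DressedWilsonHalfVertex` (`μ ≠ α`: the edge current `∓½·curvAdj F_{μα}`): for `μ = α` the resummed half-vertex is `0`, because
# the same-axis biweighted contraction of an3's cubic table is zero (`GAN24.WilsonEdgeCurrentDiag`); so every axis pair `(μ, α)` is now covered

NOT IN PRINT; OUR BOOKKEEPING ([folklore] finite-support bookkeeping BY NAME over an2's `OneStepKernelFamily.vertexOfK ∕ colH`, leaf-19's `WilsonVertexTwoConst`, leaf-15's
`WilsonVertexSumZero.suppW`, this lineage's `WilsonFaceHalfVertex.hasSum_pair_wilsonA_right`, `WilsonEdgeCurrentDiag.sum_box1_biweighted_wilsonA_diag_at`,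
`DressedStepFaceCharges.hasSum_dressedStep_col`, `DressedWilsonHalfVertex.vertexOfK_wilson_inl_inl ∕ '`; G-an2-4 formalisation swarm, leaf prover `b2b-balaban-gan24-formalise-leaf-04`,
gen 66).  HONEST FRAMING (cell contract, verbatim): «discharging `BetaPertH` makes Bałaban's UV stability UNCONDITIONAL — a real constructive-QFT result; it is NOT the continuum
limit and NOT the Clay problem.»  HONEST DEPENDENCY (verbatim): «continuum YM on T⁴ ⇐ BetaPertH ∧ nine spine estimates (0/9 proved); BetaPertH ⇐ (D1) ∧ (D4) ∧ CAP+tail; G-an2-4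
gates asym, D1 and NE2/3/4.»

WHY (blueprint §6 (L2)): the SWAP word `FF[(dM_{b′}∘X̃♮)∘dM_b]` of the two-face read-out `DressedStepFaceCharges.hasSum_mmRead_K3OfK_dressedStep` carries the `α`-exit-face weight on the
`ν`-vertex and the `β`-weight on the `μ`-vertex; in the charged pattern `(μ,ν;α,β) = (μ,α;α,μ)` both half-vertices of the swap word are SAME-AXIS (`ν = α`, `μ = β`), a case the
`μ ≠ α` lemmas of `DressedWilsonHalfVertex` do not cover.  With the present same-axis zeros every downstream identity of the EE chain (`DressedKernelOnFaceCurrent`,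
`EEWordReduced`, `EEWordValue`) extends to all `(μ, ν, α, β)` with the SAME closed form (whose `E = [μ=ν][α=β] − [μ=β][α=ν]` vanishes in the degenerate cases; sequel file).

WHAT ([folklore]; generic `d`; 0 `def`, 0 cited facts, 0 `def … : Prop`, 0 sorry): §1 **`hasSum_biweighted_wilsonA_diag`** ∕ **`hasSum_biweighted_wilsonA_diag_snd`** (the same-axis
pair `HasSum`s of the cubic table are `0`, weights on (table site, first leg) resp. (table site, second leg)); §2 (in-block root, `1 ≤ Lc`, every level `j`, all units)
**`hasSum_faceHalfVertex_fst_diag`** ∕ **`hasSum_faceHalfVertex_snd_diag`** (SAME AXIS `μ = α`: the background-resummed exit-face-read dressed Wilson half-vertex has the `HasSum`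
`0`, face weight on the first resp. second leg — the complement of `DressedWilsonHalfVertex.hasSum_faceHalfVertex_fst ∕ _snd` (`μ ≠ α`), same finite bookkeeping) and the `tsum`
forms **`tsum_faceHalfVertex_fst_diag`** ∕ **`tsum_faceHalfVertex_snd_diag`**.  Together with the `μ ≠ α` lemmas every axis pair is covered (the closed form
`K₁·(∓½·curvAdj F_{μα})` of the `μ ≠ α` case is itself `0` at `μ = α`, `F_{μμ}` being the zero form).  Asserts NO value of Bałaban's tables beyond an3's DEFINED stencil;
discharges NOTHING of (C)sym ∕ (Q-D) ∕ (Q-D-rate) ∕ «T2Shape» ∕ «T2Drift» ∕ (hW, hWall); NEVER «G-an2-4 closed» as (CONV-C); NOT D1, NOT `BetaPertH`, NOT continuum, NOT Clay.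
2026-08-23; no existing file touched.
-/

noncomputable section

open Finset
open scoped BigOperators
open Literature.MathematicalPhysics.QuantumFieldTheory
open Literature.MathematicalPhysics.QuantumFieldTheory.Balaban1983to89
open Literature.MathematicalPhysics.QuantumFieldTheory.Balaban1983to89.Beta
open ExpKernelCalculus (Site MKer)
open OneStepResolventKernel (Fib wsum)
open OneStepKernelFamily (KInvStep colH vertexOfK)
open StepJetData (wilsonA wilsonA_antisymm)
open BalabanStepJets (box1)
open AffineAveraging (box toSite)
open Summit.QuantumFields.BalabanUV.Beta.AxialDressingRooted (coDressKBmAt)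
open Summit.QuantumFields.BalabanUV.Beta.HessKerDressedUnits (unitK unitS)
open Summit.QuantumFields.BalabanUV.Beta.GAN24.WilsonVertexSumZero (suppW wilsonA_eq_zero_left wilsonA_eq_zero_right)
open Summit.QuantumFields.BalabanUV.Beta.GAN24.WilsonVertexTwoConst (mem_biUnion_of_wilsonA_ne_zero_left mem_biUnion_of_wilsonA_ne_zero_right)
open Summit.QuantumFields.BalabanUV.Beta.GAN24.DressedStepFaceCharges (hasSum_dressedStep_col)
open Summit.QuantumFields.BalabanUV.Beta.GAN24.WilsonFaceHalfVertex (hasSum_pair_wilsonA_right)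
open Summit.QuantumFields.BalabanUV.Beta.GAN24.WilsonEdgeCurrentDiag (sum_box1_biweighted_wilsonA_diag_at)
open Summit.QuantumFields.BalabanUV.Beta.GAN24.DressedWilsonHalfVertex (vertexOfK_wilson_inl_inl vertexOfK_wilson_inl_inl')

namespace Summit.QuantumFields.BalabanUV.Beta.GAN24.DressedWilsonHalfVertexAnyAxis

variable {d : ℕ}

/-! ## §1 Same-axis pair sums vanish; the biweighted pair sums for every axis pair -/

/-- [folklore] **THE SAME-AXIS BIWEIGHTED PAIR `tsum` OF THE CUBIC WILSON TABLE IS ZERO** (weights `p` on the table site's `γ`-coordinate and `q` on the FIRST leg's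
`γ`-coordinate, first leg read in direction `γ`, second leg `(b, z)` free; all `p q : ℤ → ℝ`): `WilsonFaceHalfVertex.hasSum_pair_wilsonA_right` ⨾
`WilsonEdgeCurrentDiag.sum_box1_biweighted_wilsonA_diag_at`. -/
theorem hasSum_biweighted_wilsonA_diag (γ : Fin (d + 1)) (p q : ℤ → ℝ) (b : Fin (d + 1)) (z : Site (d + 1)) :
    HasSum (fun tw : Site (d + 1) × Site (d + 1) => p (tw.1 γ) * q (tw.2 γ) * wilsonA d γ tw.1 tw.2 z (Sum.inl γ) (Sum.inl b)) 0 := by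
  have h := hasSum_pair_wilsonA_right (d := d) γ (fun t w => p (t γ) * q (w γ)) z γ b
  rwa [sum_box1_biweighted_wilsonA_diag_at γ p q b z] at h

/-- [folklore] **… WEIGHTS ON (TABLE SITE, SECOND LEG), SECOND LEG READ IN DIRECTION `γ`: ALSO ZERO** (leg antisymmetry of an3's table, `StepJetData.wilsonA_antisymm`). -/
theorem hasSum_biweighted_wilsonA_diag_snd (γ : Fin (d + 1)) (p q : ℤ → ℝ) (b : Fin (d + 1)) (z : Site (d + 1)) :
    HasSum (fun tw : Site (d + 1) × Site (d + 1) => p (tw.1 γ) * q (tw.2 γ) * wilsonA d γ tw.1 z tw.2 (Sum.inl b) (Sum.inl γ)) 0 := by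
  have h := (hasSum_biweighted_wilsonA_diag γ p q b z).neg
  have e : ∀ tw : Site (d + 1) × Site (d + 1), p (tw.1 γ) * q (tw.2 γ) * wilsonA d γ tw.1 z tw.2 (Sum.inl b) (Sum.inl γ) =
      -(p (tw.1 γ) * q (tw.2 γ) * wilsonA d γ tw.1 tw.2 z (Sum.inl γ) (Sum.inl b)) := by
    intro tw
    rw [wilsonA_antisymm γ tw.1 tw.2 z (Sum.inl γ) (Sum.inl b)]
    ring
  simp_rw [e]
  rwa [neg_zero] at h

/-! ## §2 The same-axis face-weighted dressed half-vertices resummed over the background bond: zero -/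

section Resummed

variable {Lc : ℕ} [NeZero Lc] {r : Fin (d + 1) → ℕ} {μ : Fin (d + 1)}

/-- [folklore] **SAME AXIS, FACE WEIGHT ON THE FIRST LEG: THE BACKGROUND-RESUMMED DRESSED WILSON HALF-VERTEX HAS THE `HasSum` ZERO** (in-block root `ρ = toSite r`,
`1 ≤ Lc`, every level `j`, all units): the family `u ↦ Σ'_y 𝟙f(y_μ)·vertexOfK X̃♮_j Lc S^E μ u y z (inl μ) (inl a)` (left half-vertex sourced by the background bond `(μ, u)`,
read on its first leg at the `μ`-exit face — the SAME axis — second leg `(a, z)` free) sums to `0`: the finite bookkeeping of `DressedWilsonHalfVertex.hasSum_faceHalfVertex_fst`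
with the pair value of §1 `hasSum_biweighted_wilsonA_diag`. -/
theorem hasSum_faceHalfVertex_fst_diag (hLc : 1 ≤ Lc) (hr : r ∈ box (d + 1) Lc) (sf sm cE : ℝ) (j : ℕ) (a : Fin (d + 1)) (z : Site (d + 1)) :
    HasSum (fun u : Site (d + 1) => ∑' y : Site (d + 1), (if y μ % (Lc : ℤ) = (Lc : ℤ) - 1 then (1 : ℝ) else 0) *
        vertexOfK (unitK sf sm (coDressKBmAt (toSite r) Lc (KInvStep (d := d) Lc j))) Lc (unitS sf sm (fun κ v => cE • wilsonA d κ v)) μ u y z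
          (Sum.inl μ) (Sum.inl a)) 0 := by
  classical
  set X := unitK sf sm (coDressKBmAt (toSite r) Lc (KInvStep (d := d) Lc j)) with hX
  set p : ℤ → ℝ := fun n => if n % (Lc : ℤ) = (Lc : ℤ) - 1 then (1 : ℝ) else 0 with hp
  set U : Finset (Site (d + 1)) := (box1 (d + 1)).image (fun v => z - v) with hU
  set c : ℝ := (sf * sm)⁻¹ * (sf⁻¹ * sf⁻¹) * cE with hc
  show HasSum (fun u : Site (d + 1) => ∑' y : Site (d + 1), p (y μ) * vertexOfK X Lc (unitS sf sm (fun κ v => cE • wilsonA d κ v)) μ u y z (Sum.inl μ) (Sum.inl a)) 0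
  -- the `y`-weighted table entry at a window site `t`, as a finite sum
  set W : Fin (d + 1) → Site (d + 1) → ℝ := fun κ t => ∑ y ∈ U.biUnion (suppW κ), p (y μ) * wilsonA d κ t y z (Sum.inl μ) (Sum.inl a) with hW
  have hWt : ∀ κ, ∀ t ∈ U, (∑' y : Site (d + 1), p (y μ) * wilsonA d κ t y z (Sum.inl μ) (Sum.inl a)) = W κ t := by
    intro κ t ht
    refine tsum_eq_sum fun y hy => ?_
    have hy' : y ∉ suppW κ t := fun h => hy (Finset.mem_biUnion.2 ⟨t, ht, h⟩)
    rw [wilsonA_eq_zero_left κ t hy' z μ a, mul_zero]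
  -- step 1: the `y`-sum of the face-weighted vertex, pointwise in `u`
  have step1 : ∀ u, (∑' y : Site (d + 1), p (y μ) * vertexOfK X Lc (unitS sf sm (fun κ v => cE • wilsonA d κ v)) μ u y z (Sum.inl μ) (Sum.inl a)) =
      c * ∑ κ : Fin (d + 1), ∑ t ∈ U, colH X Lc μ u κ t * W κ t := by
    intro u
    have e : ∀ y, p (y μ) * vertexOfK X Lc (unitS sf sm (fun κ v => cE • wilsonA d κ v)) μ u y z (Sum.inl μ) (Sum.inl a) =
        ∑ κ : Fin (d + 1), ∑ t ∈ U, c * colH X Lc μ u κ t * (p (y μ) * wilsonA d κ t y z (Sum.inl μ) (Sum.inl a)) := by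
      intro y
      rw [vertexOfK_wilson_inl_inl, Finset.mul_sum, Finset.mul_sum]
      refine Finset.sum_congr rfl fun κ _ => ?_
      rw [Finset.mul_sum, Finset.mul_sum]
      exact Finset.sum_congr rfl fun t _ => by ring
    have hs : ∀ κ, ∀ t, Summable fun y : Site (d + 1) => c * colH X Lc μ u κ t * (p (y μ) * wilsonA d κ t y z (Sum.inl μ) (Sum.inl a)) := by
      intro κ t
      refine summable_of_ne_finset_zero (s := suppW κ t) fun y hy => ?_
      rw [wilsonA_eq_zero_left κ t hy z μ a]; ring
    rw [tsum_congr e, Summable.tsum_finsetSum (fun κ _ => summable_sum fun t _ => hs κ t), Finset.mul_sum]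
    refine Finset.sum_congr rfl fun κ _ => ?_
    rw [Summable.tsum_finsetSum (fun t _ => hs κ t), Finset.mul_sum]
    refine Finset.sum_congr rfl fun t ht => ?_
    rw [tsum_mul_left, hWt κ t ht]
    ring
  simp_rw [step1]
  -- step 2: sum over the background bond `u` through the dressed column charge
  have step2 : HasSum (fun u : Site (d + 1) => c * ∑ κ : Fin (d + 1), ∑ t ∈ U, colH X Lc μ u κ t * W κ t)
      (c * ∑ κ : Fin (d + 1), ∑ t ∈ U, (if t κ % (Lc : ℤ) = (Lc : ℤ) - 1 then ((Lc : ℝ) * (sm * sf)) *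
        (if κ = μ then ((((Lc ^ (j + 1) : ℕ) : ℝ)) ^ (d + 1 + 1))⁻¹ else 0) else 0) * W κ t) := by
    refine HasSum.mul_left c (hasSum_sum fun κ _ => hasSum_sum fun t _ => ?_)
    exact (hasSum_dressedStep_col (d := d) hLc hr sf sm j μ (Sum.inl κ) t).mul_right (W κ t)
  convert step2 using 1
  -- step 3: only `κ = μ` survives; the finite double sum is the (vanishing) same-axis pair `HasSum` of §1
  rw [Finset.sum_eq_single μ (fun κ _ hκ => Finset.sum_eq_zero fun t _ => by rw [if_neg hκ]; simp) (fun h => absurd (Finset.mem_univ μ) h)]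
  simp only [if_true]
  have hval : ∑ t ∈ U, p (t μ) * W μ t = 0 := by
    have h7 := hasSum_biweighted_wilsonA_diag (d := d) μ p p a z
    have hz : ∀ tw ∉ U ×ˢ U.biUnion (suppW μ), p (tw.1 μ) * p (tw.2 μ) * wilsonA d μ tw.1 tw.2 z (Sum.inl μ) (Sum.inl a) = 0 := by
      intro tw htw
      by_contra hne
      exact htw (Finset.mem_product.2 (mem_biUnion_of_wilsonA_ne_zero_left μ (right_ne_zero_of_mul hne)))
    rw [← (hasSum_sum_of_ne_finset_zero hz).unique h7, Finset.sum_product]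
    refine Finset.sum_congr rfl fun t _ => ?_
    rw [hW, Finset.mul_sum]
    exact Finset.sum_congr rfl fun y _ => by ring
  have e3 : ∀ t ∈ U, (if t μ % (Lc : ℤ) = (Lc : ℤ) - 1 then ((Lc : ℝ) * (sm * sf)) * ((((Lc ^ (j + 1) : ℕ) : ℝ)) ^ (d + 1 + 1))⁻¹ else 0) * W μ t =
      (((Lc : ℝ) * (sm * sf)) * ((((Lc ^ (j + 1) : ℕ) : ℝ)) ^ (d + 1 + 1))⁻¹) * (p (t μ) * W μ t) := by
    intro t _
    simp only [hp]
    split_ifs <;> ring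
  rw [Finset.sum_congr rfl e3, ← Finset.mul_sum, hval]
  ring

/-- [folklore] **SAME AXIS, FACE WEIGHT ON THE SECOND LEG: THE BACKGROUND-RESUMMED DRESSED WILSON HALF-VERTEX HAS THE `HasSum` ZERO**: the family
`u ↦ Σ'_w 𝟙f(w_μ)·vertexOfK X̃♮_j Lc S^E μ u y w (inl b) (inl μ)` (second leg read at the `μ`-exit face, first leg `(b, y)` free) sums to `0` (bookkeeping of
`DressedWilsonHalfVertex.hasSum_faceHalfVertex_snd`, pair value §1 `hasSum_biweighted_wilsonA_diag_snd`). -/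
theorem hasSum_faceHalfVertex_snd_diag (hLc : 1 ≤ Lc) (hr : r ∈ box (d + 1) Lc) (sf sm cE : ℝ) (j : ℕ) (b : Fin (d + 1)) (y : Site (d + 1)) :
    HasSum (fun u : Site (d + 1) => ∑' w : Site (d + 1), (if w μ % (Lc : ℤ) = (Lc : ℤ) - 1 then (1 : ℝ) else 0) *
        vertexOfK (unitK sf sm (coDressKBmAt (toSite r) Lc (KInvStep (d := d) Lc j))) Lc (unitS sf sm (fun κ v => cE • wilsonA d κ v)) μ u y w
          (Sum.inl b) (Sum.inl μ)) 0 := by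
  classical
  set X := unitK sf sm (coDressKBmAt (toSite r) Lc (KInvStep (d := d) Lc j)) with hX
  set p : ℤ → ℝ := fun n => if n % (Lc : ℤ) = (Lc : ℤ) - 1 then (1 : ℝ) else 0 with hp
  set U : Finset (Site (d + 1)) := (box1 (d + 1)).image (fun v => y - v) with hU
  set c : ℝ := (sf * sm)⁻¹ * (sf⁻¹ * sf⁻¹) * cE with hc
  show HasSum (fun u : Site (d + 1) => ∑' w : Site (d + 1), p (w μ) * vertexOfK X Lc (unitS sf sm (fun κ v => cE • wilsonA d κ v)) μ u y w (Sum.inl b) (Sum.inl μ)) 0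
  set W : Fin (d + 1) → Site (d + 1) → ℝ := fun κ t => ∑ w ∈ U.biUnion (suppW κ), p (w μ) * wilsonA d κ t y w (Sum.inl b) (Sum.inl μ) with hW
  have hWt : ∀ κ, ∀ t ∈ U, (∑' w : Site (d + 1), p (w μ) * wilsonA d κ t y w (Sum.inl b) (Sum.inl μ)) = W κ t := by
    intro κ t ht
    refine tsum_eq_sum fun w hw => ?_
    have hw' : w ∉ suppW κ t := fun h => hw (Finset.mem_biUnion.2 ⟨t, ht, h⟩)
    rw [wilsonA_eq_zero_right κ t y hw' b μ, mul_zero]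
  have step1 : ∀ u, (∑' w : Site (d + 1), p (w μ) * vertexOfK X Lc (unitS sf sm (fun κ v => cE • wilsonA d κ v)) μ u y w (Sum.inl b) (Sum.inl μ)) =
      c * ∑ κ : Fin (d + 1), ∑ t ∈ U, colH X Lc μ u κ t * W κ t := by
    intro u
    have e : ∀ w, p (w μ) * vertexOfK X Lc (unitS sf sm (fun κ v => cE • wilsonA d κ v)) μ u y w (Sum.inl b) (Sum.inl μ) =
        ∑ κ : Fin (d + 1), ∑ t ∈ U, c * colH X Lc μ u κ t * (p (w μ) * wilsonA d κ t y w (Sum.inl b) (Sum.inl μ)) := by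
      intro w
      rw [vertexOfK_wilson_inl_inl', Finset.mul_sum, Finset.mul_sum]
      refine Finset.sum_congr rfl fun κ _ => ?_
      rw [Finset.mul_sum, Finset.mul_sum]
      exact Finset.sum_congr rfl fun t _ => by ring
    have hs : ∀ κ, ∀ t, Summable fun w : Site (d + 1) => c * colH X Lc μ u κ t * (p (w μ) * wilsonA d κ t y w (Sum.inl b) (Sum.inl μ)) := by
      intro κ t
      refine summable_of_ne_finset_zero (s := suppW κ t) fun w hw => ?_
      rw [wilsonA_eq_zero_right κ t y hw b μ]; ring
    rw [tsum_congr e, Summable.tsum_finsetSum (fun κ _ => summable_sum fun t _ => hs κ t), Finset.mul_sum]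
    refine Finset.sum_congr rfl fun κ _ => ?_
    rw [Summable.tsum_finsetSum (fun t _ => hs κ t), Finset.mul_sum]
    refine Finset.sum_congr rfl fun t ht => ?_
    rw [tsum_mul_left, hWt κ t ht]
    ring
  simp_rw [step1]
  have step2 : HasSum (fun u : Site (d + 1) => c * ∑ κ : Fin (d + 1), ∑ t ∈ U, colH X Lc μ u κ t * W κ t)
      (c * ∑ κ : Fin (d + 1), ∑ t ∈ U, (if t κ % (Lc : ℤ) = (Lc : ℤ) - 1 then ((Lc : ℝ) * (sm * sf)) *
        (if κ = μ then ((((Lc ^ (j + 1) : ℕ) : ℝ)) ^ (d + 1 + 1))⁻¹ else 0) else 0) * W κ t) := by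
    refine HasSum.mul_left c (hasSum_sum fun κ _ => hasSum_sum fun t _ => ?_)
    exact (hasSum_dressedStep_col (d := d) hLc hr sf sm j μ (Sum.inl κ) t).mul_right (W κ t)
  convert step2 using 1
  rw [Finset.sum_eq_single μ (fun κ _ hκ => Finset.sum_eq_zero fun t _ => by rw [if_neg hκ]; simp) (fun h => absurd (Finset.mem_univ μ) h)]
  simp only [if_true]
  have hval : ∑ t ∈ U, p (t μ) * W μ t = 0 := by
    have h7 := hasSum_biweighted_wilsonA_diag_snd (d := d) μ p p b y
    have hz : ∀ tw ∉ U ×ˢ U.biUnion (suppW μ), p (tw.1 μ) * p (tw.2 μ) * wilsonA d μ tw.1 y tw.2 (Sum.inl b) (Sum.inl μ) = 0 := by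
      intro tw htw
      by_contra hne
      exact htw (Finset.mem_product.2 (mem_biUnion_of_wilsonA_ne_zero_right μ (right_ne_zero_of_mul hne)))
    rw [← (hasSum_sum_of_ne_finset_zero hz).unique h7, Finset.sum_product]
    refine Finset.sum_congr rfl fun t _ => ?_
    rw [hW, Finset.mul_sum]
    exact Finset.sum_congr rfl fun w _ => by ring
  have e3 : ∀ t ∈ U, (if t μ % (Lc : ℤ) = (Lc : ℤ) - 1 then ((Lc : ℝ) * (sm * sf)) * ((((Lc ^ (j + 1) : ℕ) : ℝ)) ^ (d + 1 + 1))⁻¹ else 0) * W μ t =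
      (((Lc : ℝ) * (sm * sf)) * ((((Lc ^ (j + 1) : ℕ) : ℝ)) ^ (d + 1 + 1))⁻¹) * (p (t μ) * W μ t) := by
    intro t _
    simp only [hp]
    split_ifs <;> ring
  rw [Finset.sum_congr rfl e3, ← Finset.mul_sum, hval]
  ring

/-- [folklore] `tsum` form: **SAME AXIS, FACE WEIGHT ON THE FIRST LEG — `Σ'_u Σ'_y 𝟙f(y_μ)·V_{μ,u} y z (inl μ)(inl a) = 0`.** -/
theorem tsum_faceHalfVertex_fst_diag (hLc : 1 ≤ Lc) (hr : r ∈ box (d + 1) Lc) (sf sm cE : ℝ) (j : ℕ) (a : Fin (d + 1)) (z : Site (d + 1)) :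
    ∑' u : Site (d + 1), ∑' y : Site (d + 1), (if y μ % (Lc : ℤ) = (Lc : ℤ) - 1 then (1 : ℝ) else 0) *
        vertexOfK (unitK sf sm (coDressKBmAt (toSite r) Lc (KInvStep (d := d) Lc j))) Lc (unitS sf sm (fun κ v => cE • wilsonA d κ v)) μ u y z
          (Sum.inl μ) (Sum.inl a) = 0 :=
  (hasSum_faceHalfVertex_fst_diag hLc hr sf sm cE j a z).tsum_eq

/-- [folklore] `tsum` form: **SAME AXIS, FACE WEIGHT ON THE SECOND LEG — `Σ'_u Σ'_w 𝟙f(w_μ)·V_{μ,u} y w (inl b)(inl μ) = 0`.** -/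
theorem tsum_faceHalfVertex_snd_diag (hLc : 1 ≤ Lc) (hr : r ∈ box (d + 1) Lc) (sf sm cE : ℝ) (j : ℕ) (b : Fin (d + 1)) (y : Site (d + 1)) :
    ∑' u : Site (d + 1), ∑' w : Site (d + 1), (if w μ % (Lc : ℤ) = (Lc : ℤ) - 1 then (1 : ℝ) else 0) *
        vertexOfK (unitK sf sm (coDressKBmAt (toSite r) Lc (KInvStep (d := d) Lc j))) Lc (unitS sf sm (fun κ v => cE • wilsonA d κ v)) μ u y w
          (Sum.inl b) (Sum.inl μ) = 0 :=
  (hasSum_faceHalfVertex_snd_diag hLc hr sf sm cE j b y).tsum_eq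

end Resummed

end Summit.QuantumFields.BalabanUV.Beta.GAN24.DressedWilsonHalfVertexAnyAxis

end
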